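import Literature.Geometry.Lorentzian.KerrSchild
import Literature.Analysis.Calculus.SmoothCutoff
import Mathlib.Analysis.SpecialFunctions.Log.Deriv
import HarnessLib

/-!
# `KerrShieldedDataExist` — the hard-coded bent height `T_{M,a}` and its slope (part 1 of 3)

Support lemmas for crux `stmt-FinalStateConjecture-10055`
(`Summit.FinalStateConjecture.FinalStateConjecture.Theses.SwallowTheDatum.KerrShieldedDataExist`; the
same height is hard-coded in `ParametricKerrBurial` and `KerrShieldedSettles` of route SwallowTheDatum),
from the standing disprover's work file `Cruxes/KerrShieldedDataExist/Disproof.lean` (§2–§3), landed so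
that provers / planners / ideators can import them.

The crux pins the immersion `ψ` to the graph `t* = T(r)` of the LITERAL height
`T(r) = χ(r/4M − 1) · (F(r) − F(4M))`, `χ = Real.smoothTransition`,
`F(r) = (M/√(M²−a²)) (r₊ log(r − r₊) − r₋ log(r − r₋))` (Boyer–Lindquist height: `F′ = 2Mr/Δ = d(r* − r)/dr`).
This file: parameter algebra of the junction window (`Δ = (r − r₊)(r − r₋)`, `r₊ < 4M`),
`bentHeight_eq_literal` (`rfl` with the crux's lambda), `bentHeight_eq_zero_of_le` (NO JUNK LEAKS: the
`Real.log` of nonpositive arguments at `r ≤ r₊ < 4M` is multiplied by an exact `0`), `hasDerivAt_blHeight`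
(`F′ = 2Mr/Δ` on `r > r₊`), the total slope function `bentSlope` and `hasDerivAt_bentHeight` /
`deriv_bentHeight` (`T` is differentiable on all of `ℝ` with `T′ = bentSlope`; `T′ = 0` below `4M`,
`T′ = 2Mr/Δ` beyond `8M`). Parts 2–3 (`BentSlopeBounds`, `BentSliceConormal`) bound the slope and prove
that the conormal form of the graph is negative everywhere (the slice clause of the crux cannot fail).

Differentiability of `χ` and the vanishing of `χ′` off `(0, 1)` are the tree's
`Literature.Analysis.Calculus.differentiable_smoothTransition` / `deriv_smoothTransition_of_nonpos` /
`deriv_smoothTransition_of_one_le` (`SmoothCutoff.lean`).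
References: Dafermos–Rodnianski arXiv:0811.0354 §5.1; Cook, Living Rev. Relativ. 3 (2000) §3.2.2.
-/

noncomputable section

open Real Set Filter Topology
open scoped Manifold ContDiff
open Literature.Geometry.Lorentzian
open Literature.Analysis.Calculus (differentiable_smoothTransition deriv_smoothTransition_of_nonpos
  deriv_smoothTransition_of_one_le)

namespace Summit.FinalStateConjecture.FinalStateConjecture.Theorems.KerrShieldedDataExist.Negative

/-! ## §2 Parameter algebra of the junction window -/

section Params

variable {M a : ℝ}

/-- `|a| < M` gives `0 < M`. [folklore] -/
theorem mass_pos (h : |a| < M) : 0 < M := (abs_nonneg a).trans_lt h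

/-- `|a| < M` gives `0 < M² − a²`. [folklore] -/
theorem sq_sub_sq_pos (h : |a| < M) : 0 < M ^ 2 - a ^ 2 := by
  have ha : a ^ 2 < M ^ 2 := sq_lt_sq' (abs_lt.1 h).1 (abs_lt.1 h).2
  linarith

/-- `s = √(M² − a²) > 0` for sub-extremal parameters. [folklore] -/
theorem sqrt_pos' (h : |a| < M) : 0 < Real.sqrt (M ^ 2 - a ^ 2) :=
  Real.sqrt_pos.2 (sq_sub_sq_pos h)

/-- `s² = M² − a²`. [folklore] -/
theorem sq_sqrt' (h : |a| < M) : Real.sqrt (M ^ 2 - a ^ 2) ^ 2 = M ^ 2 - a ^ 2 :=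
  Real.sq_sqrt (sq_sub_sq_pos h).le

/-- `√(M² − a²) ≤ M`. [folklore] -/
theorem sqrt_le_mass (h : |a| < M) : Real.sqrt (M ^ 2 - a ^ 2) ≤ M := by
  have h1 : Real.sqrt (M ^ 2 - a ^ 2) ≤ Real.sqrt (M ^ 2) :=
    Real.sqrt_le_sqrt (by nlinarith [sq_nonneg a])
  rwa [Real.sqrt_sq (mass_pos h).le] at h1

/-- `r₊ + r₋ = 2M`. [folklore] -/
theorem rPlus_add_rMinus (M a : ℝ) : Kerr.rPlus M a + Kerr.rMinus M a = 2 * M := by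
  unfold Kerr.rPlus Kerr.rMinus; ring

/-- `r₊ − r₋ = 2√(M² − a²)`. [folklore] -/
theorem rPlus_sub_rMinus (M a : ℝ) :
    Kerr.rPlus M a - Kerr.rMinus M a = 2 * Real.sqrt (M ^ 2 - a ^ 2) := by
  unfold Kerr.rPlus Kerr.rMinus; ring

/-- `r₊ r₋ = a²` (sub-extremal). [folklore] -/
theorem rPlus_mul_rMinus (h : |a| < M) : Kerr.rPlus M a * Kerr.rMinus M a = a ^ 2 := by
  unfold Kerr.rPlus Kerr.rMinus
  nlinarith [sq_sqrt' h]

/-- `Δ(r) = r² − 2Mr + a² = (r − r₊)(r − r₋)` (sub-extremal). [folklore] -/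
theorem delta_factor (h : |a| < M) (r : ℝ) :
    r ^ 2 - 2 * M * r + a ^ 2 = (r - Kerr.rPlus M a) * (r - Kerr.rMinus M a) := by
  have h1 := rPlus_add_rMinus M a
  have h2 := rPlus_mul_rMinus h
  linear_combination -h2 + r * h1

/-- `r₊ ≤ 2M` (`√(M²−a²) ≤ M`). [folklore] -/
theorem rPlus_le_two_mul (h : |a| < M) : Kerr.rPlus M a ≤ 2 * M := by
  unfold Kerr.rPlus; linarith [sqrt_le_mass h]

/-- `r₊ < 4M`: the junk zone of `Real.log (r − r±)` lies strictly below the transition. [folklore] -/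
theorem rPlus_lt_four_mul (h : |a| < M) : Kerr.rPlus M a < 4 * M := by
  linarith [rPlus_le_two_mul h, mass_pos h]

/-- `0 ≤ r₋` (sub-extremal). [folklore] -/
theorem rMinus_nonneg (h : |a| < M) : 0 ≤ Kerr.rMinus M a :=
  Kerr.IsSubextremal.rMinus_nonneg h

/-- `r₋ < r₊` (sub-extremal). [folklore] -/
theorem rMinus_lt_rPlus (h : |a| < M) : Kerr.rMinus M a < Kerr.rPlus M a :=
  Kerr.IsSubextremal.rMinus_lt_rPlus h

-- (`abs_lt_of_window`, `no_window_of_not_subextremal`: see `NoWindowOfNotSubextremal.lean` in this directory.)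

/-- `Δ(r) > 0` for `r > r₊`. [folklore] -/
theorem delta_pos (h : |a| < M) {r : ℝ} (hr : Kerr.rPlus M a < r) :
    0 < r ^ 2 - 2 * M * r + a ^ 2 := by
  rw [delta_factor h]
  exact mul_pos (sub_pos.2 hr) (sub_pos.2 ((rMinus_lt_rPlus h).trans hr))

/-- `Δ(r) ≥ r(r − 2M)`. [folklore] -/
theorem delta_ge (M a r : ℝ) : r * (r - 2 * M) ≤ r ^ 2 - 2 * M * r + a ^ 2 := by
  nlinarith [sq_nonneg a]

end Params

/-! ## §3 The hard-coded height `T_{M,a}` and its slope -/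

section Height

variable {M a : ℝ}

/-- The Boyer–Lindquist height `F(r) = (M/√(M²−a²)) (r₊ log(r − r₊) − r₋ log(r − r₋))`
(`= r* − r` up to an additive constant on `r > r₊`). [cite: arXiv08110354, §5.1] -/
def blHeight (M a : ℝ) (r : ℝ) : ℝ :=
  M / Real.sqrt (M ^ 2 - a ^ 2) *
    (Kerr.rPlus M a * Real.log (r - Kerr.rPlus M a) - Kerr.rMinus M a * Real.log (r - Kerr.rMinus M a))

/-- The crux's hard-coded bent height, LITERALLY: `T(r) = χ(r/4M − 1) · (F(r) − F(4M))` with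
`χ = Real.smoothTransition`. [cite: arXiv08110354, §5.1] -/
def bentHeight (M a : ℝ) (r : ℝ) : ℝ :=
  Real.smoothTransition (r / (4 * M) - 1) * (blHeight M a r - blHeight M a (4 * M))

/-- `bentHeight M a` is, by `rfl`, the lambda hard-coded in the crux (`T = fun r ↦ …`). [folklore] -/
theorem bentHeight_eq_literal (M a : ℝ) :
    bentHeight M a = (fun r : ℝ => Real.smoothTransition (r / (4 * M) - 1) * (((M) / Real.sqrt ((M) ^ 2 - (a) ^ 2)) * (Literature.Geometry.Lorentzian.Kerr.rPlus M a * Real.log (r - Literature.Geometry.Lorentzian.Kerr.rPlus M a) - Literature.Geometry.Lorentzian.Kerr.rMinus M a * Real.log (r - Literature.Geometry.Lorentzian.Kerr.rMinus M a)) - ((M) / Real.sqrt ((M) ^ 2 - (a) ^ 2)) * (Literature.Geometry.Lorentzian.Kerr.rPlus M a * Real.log ((4 * M) - Literature.Geometry.Lorentzian.Kerr.rPlus M a) - Literature.Geometry.Lorentzian.Kerr.rMinus M a * Real.log ((4 * M) - Literature.Geometry.Lorentzian.Kerr.rMinus M a)))) :=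
  rfl

/-- Below the transition the cutoff argument is nonpositive: `r ≤ 4M ⇒ r/(4M) − 1 ≤ 0` (`M > 0`).
[folklore] -/
theorem arg_nonpos (hM : 0 < M) {r : ℝ} (hr : r ≤ 4 * M) : r / (4 * M) - 1 ≤ 0 := by
  rw [sub_nonpos, div_le_one (by linarith)]; exact hr

/-- Above the transition the cutoff argument is at least one: `8M ≤ r ⇒ 1 ≤ r/(4M) − 1`. [folklore] -/
theorem one_le_arg (hM : 0 < M) {r : ℝ} (hr : 8 * M ≤ r) : 1 ≤ r / (4 * M) - 1 := by
  rw [le_sub_iff_add_le, le_div_iff₀ (by linarith)]; linarith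

/-- **No junk leaks:** `T ≡ 0` on `r ≤ 4M` (so the undefined `Real.log` of nonpositive arguments at
`r ≤ r₊ < 4M` is multiplied by an exact `0`). [folklore] -/
theorem bentHeight_eq_zero_of_le (hM : 0 < M) {r : ℝ} (hr : r ≤ 4 * M) : bentHeight M a r = 0 := by
  simp [bentHeight, Real.smoothTransition.zero_of_nonpos (arg_nonpos hM hr)]

/-- Beyond `8M` the slice is the Boyer–Lindquist slice: `T = F − F(4M)`. [folklore] -/
theorem bentHeight_eq_of_ge (hM : 0 < M) {r : ℝ} (hr : 8 * M ≤ r) :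
    bentHeight M a r = blHeight M a r - blHeight M a (4 * M) := by
  simp [bentHeight, Real.smoothTransition.one_of_one_le (one_le_arg hM hr)]

/-- `F′(r) = 2Mr/Δ` for `r > r₊` (so `t* = T(r) + const` is `t_BL = const` beyond `8M`).
[cite: arXiv08110354, §5.1] -/
theorem hasDerivAt_blHeight (h : |a| < M) {r : ℝ} (hr : Kerr.rPlus M a < r) :
    HasDerivAt (blHeight M a) (2 * M * r / (r ^ 2 - 2 * M * r + a ^ 2)) r := by
  have hrp : r - Kerr.rPlus M a ≠ 0 := (sub_pos.2 hr).ne'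
  have hrm' : Kerr.rMinus M a < r := (rMinus_lt_rPlus h).trans hr
  have hrm : r - Kerr.rMinus M a ≠ 0 := (sub_pos.2 hrm').ne'
  have h1 : HasDerivAt (fun y => Real.log (y - Kerr.rPlus M a)) (1 / (r - Kerr.rPlus M a)) r := by
    have := ((hasDerivAt_id' r).sub_const (Kerr.rPlus M a)).log hrp
    simpa using this
  have h2 : HasDerivAt (fun y => Real.log (y - Kerr.rMinus M a)) (1 / (r - Kerr.rMinus M a)) r := by
    have := ((hasDerivAt_id' r).sub_const (Kerr.rMinus M a)).log hrm
    simpa using this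
  have hs := sqrt_pos' h
  have hs' : Real.sqrt (M ^ 2 - a ^ 2) ≠ 0 := hs.ne'
  have h3 : HasDerivAt (blHeight M a)
      (M / Real.sqrt (M ^ 2 - a ^ 2) *
        (Kerr.rPlus M a * (1 / (r - Kerr.rPlus M a)) -
          Kerr.rMinus M a * (1 / (r - Kerr.rMinus M a)))) r := by
    unfold blHeight
    exact ((h1.const_mul _).sub (h2.const_mul _)).const_mul _
  refine h3.congr_deriv ?_
  rw [delta_factor h]
  simp only [Kerr.rPlus, Kerr.rMinus] at hrp hrm ⊢
  field_simp
  ring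

/-- The slope of the bent height: `T′(r) = χ′(r/4M − 1)/(4M) · (F(r) − F(4M)) + χ(r/4M − 1) · 2Mr/Δ`
(a total real function; both cutoff factors vanish identically for `r ≤ 4M`). [folklore] -/
def bentSlope (M a : ℝ) (r : ℝ) : ℝ :=
  deriv Real.smoothTransition (r / (4 * M) - 1) / (4 * M) * (blHeight M a r - blHeight M a (4 * M)) +
    Real.smoothTransition (r / (4 * M) - 1) * (2 * M * r / (r ^ 2 - 2 * M * r + a ^ 2))

/-- `T′ ≡ 0` on `r ≤ 4M`. [folklore] -/
theorem bentSlope_eq_zero_of_le (hM : 0 < M) {r : ℝ} (hr : r ≤ 4 * M) : bentSlope M a r = 0 := by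
  simp [bentSlope, Real.smoothTransition.zero_of_nonpos (arg_nonpos hM hr),
    deriv_smoothTransition_of_nonpos (arg_nonpos hM hr)]

/-- `T′ = 2Mr/Δ` (the Boyer–Lindquist slope `d(r* − r)/dr`) on `8M ≤ r`. [folklore] -/
theorem bentSlope_eq_of_ge (hM : 0 < M) {r : ℝ} (hr : 8 * M ≤ r) :
    bentSlope M a r = 2 * M * r / (r ^ 2 - 2 * M * r + a ^ 2) := by
  simp [bentSlope, Real.smoothTransition.one_of_one_le (one_le_arg hM hr),
    deriv_smoothTransition_of_one_le (one_le_arg hM hr)]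

/-- **`T` is differentiable everywhere with derivative `bentSlope`** (product rule on `r > r₊`;
locally `≡ 0` on `r < 4M`; the two open sets cover `ℝ` because `r₊ < 4M`). [folklore] -/
theorem hasDerivAt_bentHeight (h : |a| < M) (r : ℝ) :
    HasDerivAt (bentHeight M a) (bentSlope M a r) r := by
  have hM := mass_pos h
  rcases lt_or_ge r (4 * M) with hr | hr
  · -- locally zero
    have hev : (bentHeight M a) =ᶠ[𝓝 r] fun _ => 0 := by
      filter_upwards [Iio_mem_nhds hr] with y hy
      exact bentHeight_eq_zero_of_le hM hy.le
    rw [bentSlope_eq_zero_of_le hM hr.le]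
    exact (hasDerivAt_const r (0:ℝ)).congr_of_eventuallyEq hev
  · have hrp : Kerr.rPlus M a < r := (rPlus_lt_four_mul h).trans_le hr
    have hχ : HasDerivAt (fun y => Real.smoothTransition (y / (4 * M) - 1))
        (deriv Real.smoothTransition (r / (4 * M) - 1) * (1 / (4 * M))) r := by
      have hin : HasDerivAt (fun y : ℝ => y / (4 * M) - 1) (1 / (4 * M)) r := by
        simpa using ((hasDerivAt_id' r).div_const (4 * M)).sub_const 1
      exact ((differentiable_smoothTransition _).hasDerivAt).comp r hin
    have hF : HasDerivAt (fun y => blHeight M a y - blHeight M a (4 * M))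
        (2 * M * r / (r ^ 2 - 2 * M * r + a ^ 2)) r := by
      simpa using (hasDerivAt_blHeight h hrp).sub_const (blHeight M a (4 * M))
    have key := hχ.mul hF
    have e : bentSlope M a r =
        deriv Real.smoothTransition (r / (4 * M) - 1) * (1 / (4 * M)) *
            (blHeight M a r - blHeight M a (4 * M)) +
          Real.smoothTransition (r / (4 * M) - 1) * (2 * M * r / (r ^ 2 - 2 * M * r + a ^ 2)) := by
      simp only [bentSlope]; ring
    rw [e]
    exact key

/-- `T` is continuous. [folklore] -/
theorem continuous_bentHeight (h : |a| < M) : Continuous (bentHeight M a) :=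
  continuous_iff_continuousAt.2 fun r => (hasDerivAt_bentHeight h r).continuousAt

/-- `deriv T = bentSlope`. [folklore] -/
theorem deriv_bentHeight (h : |a| < M) : deriv (bentHeight M a) = bentSlope M a :=
  funext fun r => (hasDerivAt_bentHeight h r).deriv

end Height


end Summit.FinalStateConjecture.FinalStateConjecture.Theorems.KerrShieldedDataExist.Negative

end
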